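import Literature.MathematicalPhysics.QuantumLattice.HeisenbergRPCorrelationBlocks
import HarnessLib

/-!
# Conjecture (S): the L-uniform strict Néel sign pattern of the spin-½ Heisenberg antiferromagnet on even tori

This file TYPES the one conjecture sentence of the cell record `pub-hubbard/STRUCTURE.md` §2 (clause 1)
as a Lean `Prop`, per the coordinator's standing rule NUMERICS ⇒ STRUCTURE ⇒ CONJECTURE
(2026-08-22): a conjecture that has survived three pre-registered predictions is typed with its
evidence ledger. Nothing here is proved or claimed; the declarations are `@[conjecture]` obligation
nodes. HONEST FRAMING: ladder R1–R4 with certified numbers; no claim on H/H₀.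

## The sentence (STRUCTURE.md §2, clause 1)

For every lattice vector `(a, b)` there are a rational `q(a,b) > 0` and an `L₀(a,b)` such that the
strict Néel sign `(-1)^(a+b) c_L(a,b) ≥ q(a,b)` holds for EVERY even `L ≥ L₀(a,b)`, where
`c_L(a,b) = heisRedCorr2 L 1 a b` is the ground-state-averaged two-point function of the `S = ½`
antiferromagnet on `(ℤ/Lℤ)²` (tree definition, KLS normalisation).

Clause 2 of (S) — "whenever such a row is certifiable in the RP–IR–Marshall class with the single
energy input it is certified by ONE finite exact-ℚ dual at symbolic `L` whose active set is
`L`-independent and carried, beyond the energy row, by the Marshall rows of the next distance shell" —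
is a statement about optimal duals of a linear relaxation and is NOT typed here (the relaxation is not
a tree object); it is recorded in STRUCTURE.md §1A C4–C7/C10 with its own tests.

## Evidence ledger (kernel theorems of record instantiating the sentence cell by cell; R2-TABLE §A10)

* `(0,1), (1,1), (0,2), (1,2), (0,3)` for every even `L ≥ 4`: `neelSignPattern_allEven`
  (`NeelSignPatternAllEven.lean`; margins `1/12, 173/10000, 37/10000, 41/10000, 17/10000`).
* `(1,2) ≤ -7/5000`, `(1,3) ≥ 1/1000`, `(2,2) ≥ 9/5000`, `(2,3) ≤ -3/5000` for every even
  `L ≥ 14` (`k ≥ 7`): `heisRedCorr2_C12_sign`, `heisRedCorr2_C13_floor`, `heisRedCorr2_C22_floor`,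
  `heisRedCorr2_C23_ceiling` (the last under the certified torus-family energy ceiling
  `Bounds.heisTL_fdc_upper_2x2`, consumed by name); `(0,5) ≤ -23/10⁶` for every even `L ≥ 6`
  (`heisRedCorr2_C05_ceiling_allEven`) and the strict `heisRedCorr2_C05_sign` (`k ≥ 7`).
* Finite-`L` instance cells at `L = 8, 10, 12, 16`, incl. `(0,4), (1,4), (2,4), (3,3), (3,4)` and
  the energy-free `(2,3)`, `(1,1)` at `L = 16` (`heisRedCorr2_sixteen_*`): consistent constants,
  no uniformity in `L` by themselves (STRUCTURE.md C9, negative N-21).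
* OPEN in the class of record (LP value 0 at kernel radius 11 and 13): L-uniform `(0,4)`, `(1,4)`,
  `(3,3)`; these are 'this relaxation cannot' facts, not evidence against (S).

## Pre-registered predictions bearing on (S) (STRUCTURE.md §3; register `STRUCTURE-PRED.tsv`)

* R2-PR-1 (r2 g28, 18:5xZ 2026-08-22; decided by kit j171654/j172804): at kernel radius 13 the
  optimal uniform `(2,3)` dual keeps the energy ceiling as its largest multiplier, the next-shell
  Marshall row `c(2,5) ≤ 0` as its dominant sign row, and ONE IR tangent at `x₀ ∈ [0.21, 0.25]` —
  HIT (a)(b)(c) (`x₀ = 0.235`, the radius-11 point).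
* L-PR-1 (lead g18): the radius-13 colgen plateau stays in `[6.5, 9.0]·10⁻⁴` — HIT (`6.56·10⁻⁴`,
  +1.5 % over radius 11: the uniform margin is radius-saturated, i.e. ONE finite dual).
* L-PR-4 (lead g18): at `L = 20` the instance duals of `(0,4)/(1,4)/(3,4)` put their dominant
  Marshall row on `(0,6)/(1,6)/(3,6)` — HIT 3/3 (and 20/21 target×L instances over `L = 12 … 32`).
* Scope MISSes (L-CAL-1, L-PR-3, L-PR-5) concern finite-`L` instance loci OFF the `(a,4)` family,
  which (S) does not claim (STRUCTURE.md §2.1 (iii), negatives N-20, N-22).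

## Falsifier

Clause 1 dies on an exact computation or certificate showing `(-1)^(a+b) c_L(a,b) ≤ 0` for some
fixed `(a,b)` along a sequence of even `L → ∞`.
-/

namespace Summit.HubbardSuperconductivity.Conjectures

open Literature.MathematicalPhysics.QuantumLattice

/-- CONJECTURE (S), clause 1 (STRUCTURE.md §2): every displacement `(a,b)` carries a strict Néel
sign with a positive rational margin `q` UNIFORM in all even side lengths `L = 2k ≥ 2k₀`:
`q ≤ (-1)^(a+b) · c_{2k}(a,b)`. Open as stated (it is implied by, and much weaker than, Néel
long-range order for `S = ½`, `d = 2`, which is itself open); instantiated cell by cell by the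
kernel theorems listed in the module docstring. [conjecture: pub-hubbard STRUCTURE.md §2 (S)] -/
@[conjecture] def NeelSignUniform : Prop :=
  ∀ a b : ℕ, ∃ q : ℚ, 0 < q ∧ ∃ k₀ : ℕ, ∀ k : ℕ, k₀ ≤ k →
    (q : ℝ) ≤ (-1 : ℝ) ^ (a + b) * heisRedCorr2 (2 * k) 1 a b

/-- The finite-range truncation of (S) that the certificate programme attacks shell by shell:
the strict uniform Néel sign for every displacement of graph distance `a + b ≤ R`. The rows of
record give `NeelSignUniformUpTo 3` outright (every even `L ≥ 4`) and, for `L ≥ 14`, the cells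
`(1,3), (2,2), (2,3)` of the `R = 4, 5` shells; `(0,4), (1,4), (0,5)`-with-margin, `(3,3)`, … are
open in the class of record. [conjecture: pub-hubbard STRUCTURE.md §2 (S), truncation] -/
@[conjecture] def NeelSignUniformUpTo (R : ℕ) : Prop :=
  ∀ a b : ℕ, a + b ≤ R → ∃ q : ℚ, 0 < q ∧ ∃ k₀ : ℕ, ∀ k : ℕ, k₀ ≤ k →
    (q : ℝ) ≤ (-1 : ℝ) ^ (a + b) * heisRedCorr2 (2 * k) 1 a b

/-- Bookkeeping (no content): the full conjecture is the conjunction of its truncations. -/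
theorem neelSignUniform_iff_forall_upTo :
    NeelSignUniform ↔ ∀ R : ℕ, NeelSignUniformUpTo R := by
  constructor
  · intro h R a b _; exact h a b
  · intro h a b; exact h (a + b) a b le_rfl

/-- Bookkeeping (no content): truncations are monotone in the range. -/
theorem neelSignUniformUpTo_mono {R R' : ℕ} (hRR' : R ≤ R') (h : NeelSignUniformUpTo R') :
    NeelSignUniformUpTo R := fun a b hab => h a b (hab.trans hRR')

end Summit.HubbardSuperconductivity.Conjectures
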